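import Summits.BirchSwinnertonDyer.BirchSwinnertonDyer.Theorems.SignedLowerHalvesKobayashiMainConjectureSmallImageAnalyticTransferRoad
import Summits.BirchSwinnertonDyer.BirchSwinnertonDyer.Theorems.SignedLowerHalvesKobayashiMainConjectureSmallImageMuTransferUnitPartner
import HarnessLib

/-!
# Route `SignedLowerHalves`, crux `KobayashiMainConjectureSmallImage` (item stmt-BirchSwinnertonDyer-19002):
# the analytic-transfer road with a UNIT partner — ZERO Iwasawa-invariant engines anywhere («L4-AN», part 3:
# planner ruling D25-1 (a)(4); cell `bsd-ssimc`, seat `bsd-ssimc-k3-c4` gen 7; a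
# `--supports stmt-BirchSwinnertonDyer-19002 --as helper` file; closes nothing)

PARTITION (cell bsd-ssimc): X7 (A7) × item 4's non-surjective `a_p = 0` window pairs with a UNIT partner
(7 recorded by gen 5: 4165m1, 20335g1, 117355j1, 158711b1, 421645e1 @ 3 via 8477b1; 126350bb1 @ 3, 431433g1 @ 5
in the unit zone) — types-the-object-of (the road's partner hypotheses discharged from `#Sel^(p)(A) = 1`,
`p ∤ ∏c(A)`, `r_an(A) = 0`, `BSD(A,p)` and published facts; NO certificate on either curve); the crux stays
OPEN; closes none; nothing booked; BSD is not proved by any of this. THEOREMS ONLY; nothing asserted.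

## What is proved

* `mu_signed_eq_zero_of_mainConjecture_of_muInvariant_eq_zero` — for `E′ = W′` good at the odd `p` with
  `a_p = 0` and conductor-level newform `f₀′`: Kobayashi's main conjecture for `(E′, p, ε)` (`hMC′`) and
  ALGEBRAIC `μ(X^ε(E′/ℚ_∞)) = 0` for every cyclotomic datum (`hμalg′`) give ANALYTIC `μ(L′) = 0` for every
  `L′` with `IsSignedPAdicLFunction f₀′ p ε L′` (the cyclotomic `ℤ_p`-extension with a generator matching the
  cyclotomic variable EXISTS: `exists_isCyclotomic_isTopGenerator_isCyclotomicVariable_holds`; then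
  `char X^ε(E′) = (ϖ′ L′)`, `ϖ′ ∈ ℤ_pˣ` by `h5`/`h3`, and `μ` of a generator is `μ` of the module).
* **`kobayashiMainConjecture_of_mazurTate_congr_of_unitPartner`** — part 2's road
  `SmallImageAnalyticTransferRoad.kobayashiMainConjecture_of_mazurTate_congr_of_mainConjecture` with the
  partner a UNIT partner `A = W′`: `#Sel^(p)(A/ℚ) = 1` (`hSel′`), `p ∤ ∏_ℓ c_ℓ(A)` (`htam′`), `r_an(A) = 0`
  (`h0′`), `BSD(A,p)` (`hB′`, a per-pair tree theorem for the recorded partners): `hMC′` is gen 5's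
  `kobayashiMainConjecture_of_selmerTrivial_of_bsdp_of_analyticRank_eq_zero` (Kobayashi Thm 1.2/4.1, Kim 2013
  Cor 3.15, period units, GZK, modularity BY NAME) and `hμalg′` is gen 5's `signedMu_eq_zero_of_selmerTrivial`
  (Kim 2013 Cor 3.15 ALONE). Conclusion `KobayashiMainConjecture W p ε` for the congruent curve `E = W` of ANY
  image and ANY rank, with NO Iwasawa-invariant certificate on E or on A: the only per-pair inputs are the
  partner's descent data, `BSD(A,p)`, the torsion iso `he`, `S₀`, the unit `c`, and the displayed Mazur–Tate
  congruence `hMT` (tier: part 1's module docstring — Corpuz–Lei 2025 Prop 4.2 PRE as printed; published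
  ingredients Vatsal 1999 / Greenberg–Vatsal 2000 §3 good case, cell memo k3c4-MEMO-7 §3 + addendum A).

## What this is NOT

Not a class theorem; not a proof of `hMT`; not a record (no `hMT` is discharged for any pair); CONDITIONAL on
the displayed hypotheses; nothing booked; BSD is not proved by any of this.

References: [GreenbergVatsal2000] Thm. (1.4); [Kobayashi2003] Thm. 1.2, Thm. 4.1, Conjecture (p. 2);
[BDKim2013] Cor. 3.15; [BDKim2009] Cor. 2.13; [Miller2011LMS] Def. 1.1; [Washington1997] §13.1.
Memo: `HOME/k3c4-MEMO-7.md` (cell bsd-ssimc).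
-/

set_option autoImplicit false
set_option linter.dupNamespace false
noncomputable section

open scoped Classical MatrixGroups ModularForm BigOperators

open CongruenceSubgroup WeierstrassCurve NumberField IsDedekindDomain
  Literature.NumberTheory.EllipticCurves
  Literature.NumberTheory.EllipticCurves.ModularForms
  Literature.NumberTheory.EllipticCurves.Rank1Residual
  Literature.NumberTheory.EllipticCurves.Rank1Residual.Typed
  Literature.NumberTheory.EllipticCurves.Kobayashi2003 ZpExtension
  Literature.NumberTheory.EllipticCurves.GreenbergVatsal2000
  Literature.NumberTheory.EllipticCurves.BDKim2009
  Literature.NumberTheory.EllipticCurves.Sprung2017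
  Summit.BirchSwinnertonDyer.Rank1Residual.X1.MuLambda
  Summit.BirchSwinnertonDyer.Rank1Residual.X11a
  Summit.BirchSwinnertonDyer.Rank1Residual.Supersingular
  Summit.BirchSwinnertonDyer.BirchSwinnertonDyer.Theorems.SmallImageAnalyticTransferRoad

namespace Summit.BirchSwinnertonDyer.BirchSwinnertonDyer.Theorems.SmallImageAnalyticTransferUnitPartner

variable {p : ℕ} [hp : Fact p.Prime]

/-- **Analytic `μ(L^ε_p(E′)) = 0` from the main conjecture for `(E′, p, ε)` and ALGEBRAIC `μ(X^ε(E′)) = 0`.**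
For `E′ = W′` good at the odd prime `p` with `a_p = 0`, its conductor-level newform `f₀′`, modularity
(`hmod`, the period ratio `ϖ′`), the period-unit facts (`h5`, `h3`: `ϖ′ ∈ ℤ_pˣ`) and Kobayashi Thm. 1.2
(`h12`): if `KobayashiMainConjecture W′ p ε` and every cyclotomic signed dual datum of `E′` has `μ = 0`,
then every `L′` with `IsSignedPAdicLFunction f₀′ p ε L′` has `μ(L′) = 0` (choose the cyclotomic extension and
generator by `exists_isCyclotomic_isTopGenerator_isCyclotomicVariable_holds`, a datum `D′`; the main
conjecture gives `char X^ε(E′) = (L′)` after the unit `ϖ′`, and `μ(L′) = μ(X^ε(E′))`). CONDITIONAL; nothing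
asserted. [cite: Kobayashi2003, Conjecture (Main Conjecture) (p. 2) and Thm. 1.2] [cite: Washington1997, §13.1 and §13.2] -/
theorem mu_signed_eq_zero_of_mainConjecture_of_muInvariant_eq_zero
    {W' : WeierstrassCurve ℚ} [W'.IsElliptic] [W'.IsGloballyMinimal]
    (h12 : Kobayashi2003.thm12_signedSelmerDual_finite_torsion)
    (h5 : realPeriodRat_eq_unit_mul_plusPeriod) (h3 : realPeriodRat_eq_unit_mul_plusPeriod_three)
    (hmod : nonempty_modularParametrizationData)
    (hp2 : p ≠ 2) (hgood' : W'.HasGoodReductionAtPrime p) (hap' : W'.frobeniusTrace p = 0) (ε : ℤˣ)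
    [NeZero (W'.conductorNorm ℤ)] {f₀' : CuspForm (Gamma0 (W'.conductorNorm ℤ)) 2}
    (hf₀' : IsNewformOf W' f₀') (hMC' : KobayashiMainConjecture W' p ε)
    (hμalg' : ∀ (κ : ZpExtension ℚ p) (γ : Field.absoluteGaloisGroup ℚ), κ.IsCyclotomic →
      κ.IsTopGenerator γ → IsCyclotomicVariable p γ → ∀ (D' : SignedSelmerDualData W' κ γ ε)
      [Module.Finite (IwasawaAlgebra p) D'.X], Module.IsTorsion (IwasawaAlgebra p) D'.X →
      muInvariant p D'.X = 0) :
    ∀ L' : IwasawaAlgebra p, IsSignedPAdicLFunction f₀' p ε L' → mu L' = 0 := by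
  intro L' hL'
  -- the cyclotomic setting
  obtain ⟨κ, hκ, γ, hγ, hγ'⟩ := exists_isCyclotomic_isTopGenerator_isCyclotomicVariable_holds p
  -- the Pollack pair of `f₀′`; `L′` is its `ε`-component
  obtain ⟨Lplus', Lminus', hPP'⟩ :=
    exists_isPollackPair (W := W') pollack_exists_plusMinusPAdicLFunction_holds hp2 hf₀' hgood' hap'
  have hLeq : L' = kobayashiL ε Lplus' Lminus' := hL'.unique (hPP'.isSignedPAdicLFunction_kobayashiL ε)
  have hL'0 : L' ≠ 0 := by
    rw [hLeq]
    unfold kobayashiL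
    split_ifs
    · exact hPP'.2.1
    · exact hPP'.1
  -- the period ratio `ϖ′`
  obtain ⟨Dm⟩ := hmod W'
  have hffm : Dm.f = f₀' := Dm.isNewformOf.unique hf₀'
  obtain ⟨ϖ', hϖpos, hϖ', -⟩ := Dm.exists_rat_mul_realPeriodRat_eq_plusPeriod
  rw [hffm] at hϖ'
  -- a datum and the main conjecture
  obtain ⟨D'⟩ := nonempty_signedSelmerDualData W' κ ε hγ
  haveI : Module.Finite (IwasawaAlgebra p) D'.X := h12.moduleFinite hp2 hgood' hap' hκ hγ D'
  have hX' : Module.IsTorsion (IwasawaAlgebra p) D'.X := h12.isTorsion hp2 hgood' hap' hκ hγ D'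
  obtain ⟨-, g', hg', hι'⟩ := hMC' κ γ hκ hγ hγ' f₀' hf₀' ϖ' hϖ' Lplus' Lminus' hPP' D'
  rw [← hLeq] at hι'
  have hirr' : W'.HasIrreducibleModPGaloisRep p :=
    hasIrreducibleModPGaloisRep_of_dvd_frobeniusTrace W' p hp2
      (W'.not_dvd_minimalDiscriminantInt_of_hasGoodReductionAtPrime' p hgood')
      (by rw [hap']; exact dvd_zero _)
  have hvϖ' : padicValRat p ϖ' = 0 :=
    padicValRat_periodRatio_eq_zero h5 h3 W' p hp2 hgood' hirr' f₀' hf₀' ϖ' hϖ'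
  obtain ⟨u', hu'⟩ := exists_units_coe_eq_ratCast hϖpos.ne' hvϖ'
  obtain ⟨hspanu', hιu'⟩ := span_C_units_mul_eq u' L'
  have hgeq : g' = PowerSeries.C (u' : ℤ_[p]) * L' :=
    iwasawaToPowerSeries_injective p (by rw [hι', hιu', hu'])
  have hgL' : D'.charIdeal = Ideal.span {L'} := by rw [hg', hgeq, hspanu']
  rw [Summit.BirchSwinnertonDyer.Rank1Residual.X1.MuPart.mu_generator_eq_muInvariant D'.X hX' hL'0 hgL']
  exact hμalg' κ γ hκ hγ hγ' D' hX'

/-- **The analytic-transfer road with a UNIT partner — zero Iwasawa-invariant engines.** `E = W` with `p`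
odd good, `a_p = 0` (ANY image, ANY rank); a partner `A = W′` good at `p` with `a_p(A) = 0`, `W[p] ≃ A[p]`
(`he`), `#Sel^(p)(A/ℚ) = 1` (`hSel′`), `p ∤ ∏_ℓ c_ℓ(A)` (`htam′`), `r_an(A) = 0` (`h0′`) and `BSD(A,p)`
(`hB′`); conductor-level newforms; `S₀ ∌ p` containing the bad places of both; a unit `c`; the displayed
Mazur–Tate congruence `hMT`. Granted BY NAME Kobayashi Thm. 1.2 / 4.1-rational (`h12`, `h41`), Kim 2013
Cor. 3.15 (`hKim13`), Kim 2009 Cor. 2.13 μ/λ (`h09`, `hKim`), the period units (`h5`, `h3`), GZK (`hGZK`),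
modularity (`hmod`, `hmod′`): `KobayashiMainConjecture W p ε`. Partner side: gen 5's
`kobayashiMainConjecture_of_selmerTrivial_of_bsdp_of_analyticRank_eq_zero` (`hMC′`) and
`signedMu_eq_zero_of_selmerTrivial` (`hμalg′`), turned analytic by
`mu_signed_eq_zero_of_mainConjecture_of_muInvariant_eq_zero`. PER PAIR; CONDITIONAL on `hMT`; closes nothing.
[cite: GreenbergVatsal2000, Thm. (1.4)] [cite: BDKim2013, Cor. 3.15 (p. 199)] [cite: BDKim2009, Cor. 2.13 (p. 187)]
[cite: Kobayashi2003, Thm. 1.2, Thm. 4.1 and Conjecture (p. 2)] [cite: Miller2011LMS, Def. 1.1] -/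
theorem kobayashiMainConjecture_of_mazurTate_congr_of_unitPartner
    {W : WeierstrassCurve ℚ} [W.IsElliptic] [W.IsGloballyMinimal]
    (h12 : Kobayashi2003.thm12_signedSelmerDual_finite_torsion)
    (h41 : Kobayashi2003.thm41_signedCharIdeal_divisibility)
    (hKim13 : BDKim2013.cor315_signedCharValue_rankZero)
    (h5 : realPeriodRat_eq_unit_mul_plusPeriod) (h3 : realPeriodRat_eq_unit_mul_plusPeriod_three)
    (h09 : cor213_signedMu_eq_zero_iff_of_torsionIso)
    (hKim : BDKim2009.cor213_signedLambda_add_sum_delta_eq_of_torsionIso)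
    (hGZK : rank_eq_analyticRank_of_analyticRank_le_one) (hmod : nonempty_modularParametrizationData)
    (hmod' : hasEntireLFunction_rat)
    (hp2 : p ≠ 2) (hgood : W.HasGoodReductionAtPrime p) (hap : W.frobeniusTrace p = 0) (ε : ℤˣ)
    [NeZero (W.conductorNorm ℤ)] {f₀ : CuspForm (Gamma0 (W.conductorNorm ℤ)) 2} (hf₀ : IsNewformOf W f₀)
    {W' : WeierstrassCurve ℚ} [W'.IsElliptic] [W'.IsGloballyMinimal]
    (hgood' : W'.HasGoodReductionAtPrime p) (hap' : W'.frobeniusTrace p = 0)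
    (he : ∃ e : geomTorsion W (p : ℤ) ≃+ geomTorsion W' (p : ℤ),
      ∀ (σ : Field.absoluteGaloisGroup ℚ) (P : geomTorsion W (p : ℤ)), e (σ • P) = σ • e P)
    (hSel' : Nat.card (W'.selmerGroup (p : ℤ)) = 1) (htam' : ¬ p ∣ W'.tamagawaProduct)
    (h0' : W'.analyticRank = 0) (hB' : BSDp W' p)
    [NeZero (W'.conductorNorm ℤ)] {f₀' : CuspForm (Gamma0 (W'.conductorNorm ℤ)) 2}
    (hf₀' : IsNewformOf W' f₀')
    (S₀ : Finset (HeightOneSpectrum (𝓞 ℚ))) (hS₀ : ∀ v ∈ S₀, ((p : ℕ) : 𝓞 ℚ) ∉ v.asIdeal)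
    (hS₀W : ∀ v : HeightOneSpectrum (𝓞 ℚ), ¬ W.HasGoodReductionAt v → v ∈ S₀)
    (hS₀W' : ∀ v : HeightOneSpectrum (𝓞 ℚ), ¬ W'.HasGoodReductionAt v → v ∈ S₀)
    {c : ℤ_[p]} (hc : IsUnit c)
    (hMT : ∀ n : ℕ, ∃ q r : IwasawaAlgebra p,
      ((mazurTateElement f₀ p n).map (algebraMap ℚ ℚ_[p]) : PowerSeries ℚ_[p]) *
            iwasawaToPowerSeries p (eulerFactorProduct W p S₀) -
          iwasawaToPowerSeries p (PowerSeries.C c) *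
            (((mazurTateElement f₀' p n).map (algebraMap ℚ ℚ_[p]) : PowerSeries ℚ_[p]) *
              iwasawaToPowerSeries p (eulerFactorProduct W' p S₀)) =
        iwasawaToPowerSeries p
          (toIwasawa p (cyclotomicOmega p n) * q + PowerSeries.C (p : ℤ_[p]) * r)) :
    KobayashiMainConjecture W p ε := by
  have hMC' : KobayashiMainConjecture W' p ε :=
    kobayashiMainConjecture_of_selmerTrivial_of_bsdp_of_analyticRank_eq_zero W' p h12 h41 hKim13 h5 h3 hGZK
      hmod' hp2 hgood' hap' hSel' htam' h0' hB' ε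
  have hμ' : ∀ L' : IwasawaAlgebra p, IsSignedPAdicLFunction f₀' p ε L' → mu L' = 0 :=
    mu_signed_eq_zero_of_mainConjecture_of_muInvariant_eq_zero h12 h5 h3 hmod hp2 hgood' hap' ε hf₀' hMC'
      (fun κ γ hκ hγ _ D' _ _ ↦ signedMu_eq_zero_of_selmerTrivial W' p h12 hKim13 hp2 hgood' hap' hSel'
        htam' hκ hγ ε D')
  exact kobayashiMainConjecture_of_mazurTate_congr_of_mainConjecture h12 h41 h5 h3 h09 hKim hmod hp2 hgood hap
    ε hf₀ hgood' hap' he hf₀' hMC' hμ' S₀ hS₀ hS₀W hS₀W' hc hMT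

end Summit.BirchSwinnertonDyer.BirchSwinnertonDyer.Theorems.SmallImageAnalyticTransferUnitPartner

end
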